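/-
K-task «TOWER», part (iii) CANDIDATE A (cell rh-split, director ORDER 23:19:55Z (I)(iii), lead RULING #343 (b):
«post the two candidate signatures and ref-2 picks»).  Class form of the B26 barrier: the class of lattice criteria
GENERATED by the thin blind model's clause list, and the theorem that no criterion of that class forces the
off-line configuration to be empty (or even to have an attained supremum abscissa).  Nothing here bears on the
truth of RH.
-/
import Summits.RiemannHypothesis.RiemannHypothesis.Theorems.Splittings.ScrewLatticeTowerThin
import HarnessLib

/-!
# The TOWER barrier in class form (candidate A: the clause-generated class)

A configuration `Z` (structure `Config`) is a family of OFF-LINE zero quadruples `{1/2 ± Re κ ± i Im κ}` with real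
multiplicities; for `ζ` RH says the off-line configuration is EMPTY.  A lattice screw criterion at step `h` is a
predicate `P` on configurations meant to be read as «`P Z` ⇒ `Z` is empty».  `ClassC h P` (candidate A): `P` is a
consequence, for some width `σ* > 0` and exponent `e > 0`, of the twelve top-level conjuncts of the thin blind model
`ScrewLatticeTower.exists_tower_thin_blind_model` — one-sided sampled bounds of the lattice fold `k ↦ Ψ_Z(kh)`
(uniform floor, ceiling, `LPSD(h)`), local finiteness and the THIN COUNT of ordinates (`≤ C T^e`), the multiplicity
band, `Σ m/γ² < ∞`, abscissae in `(0, σ*)` discrete below `σ*`.  THEOREMS: `classC_blind_to_tower` — every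
ClassC criterion is satisfied by a NON-EMPTY configuration whose supremum abscissa is not attained (the tower);
`not_criterion_of_classC` — hence no ClassC criterion implies emptiness.  Continuum-`Ψ` functionals are NOT in
this class (ref-2 g6 (q2) 23:27:02Z: the continuum `Ψ` of any off-line `ℓ¹` configuration is unbounded below), and
neither is the full lattice fold as a datum (candidate B, not a theorem: an on-line fold is Bohr-almost-periodic
and non-constant on `ℤ`, the tower's fold converges — only ONE-SIDED functionals of the fold are blind).
ζ-free, RH-free; std axioms.  Nothing here bears on the truth of RH.
-/

noncomputable section

set_option linter.dupNamespace false

open Complex Set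
open scoped ComplexConjugate Real

namespace Summit.RiemannHypothesis.RiemannHypothesis.Theorems.Splittings.ScrewLatticeTower

open Summit.RiemannHypothesis.RiemannHypothesis.Theorems.Splittings.ScrewLatticeWolff

/-- A configuration of off-line zero quadruples `{1/2 ± Re κ ± i Im κ}` with real multiplicities (the model class
of B16/B26: index type, the two multiplicity families, the two exponent families). -/
structure Config where
  /-- the index type of the quadruples -/
  ι : Type
  /-- multiplicity of the first pair -/
  m₁ : ι → ℝ
  /-- multiplicity of the second pair -/
  m₂ : ι → ℝ
  /-- exponent `κ₁ = σ + iγ₁` of the first pair -/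
  κ₁ : ι → ℂ
  /-- exponent `κ₂ = σ + iγ₂` of the second pair -/
  κ₂ : ι → ℂ

/-- The lattice fold at step `h` of the model screw function of a configuration: `k ↦ Ψ_Z(k h)`. -/
def Config.fold (Z : Config) (h : ℝ) (k : ℕ) : ℝ := modelPsi Z.m₁ Z.m₂ Z.κ₁ Z.κ₂ (k * h)

/-- The twelve top-level conjuncts of the thin blind model (`exists_tower_thin_blind_model`: part D's ten, then
(E1) the multiplicity band, then (E2) the thin count) at step `h`, width `σ*`, exponent `e`, as one predicate on
configurations (verbatim, with the lattice values written as `Z.fold h k` where they are lattice values). -/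
def ThinBlindClauses (h σs e : ℝ) (Z : Config) : Prop :=
  Nonempty Z.ι ∧
  (∀ i, 0 < Z.m₁ i ∧ 0 < Z.m₂ i) ∧
  (∀ i, 0 < (Z.κ₁ i).re ∧ (Z.κ₁ i).re < σs ∧ (Z.κ₂ i).re = (Z.κ₁ i).re) ∧
  (∀ i, 14 < (Z.κ₁ i).im ∧ 14 < (Z.κ₂ i).im) ∧
  (∀ T : ℝ, {i | (Z.κ₁ i).im ≤ T}.Finite ∧ {i | (Z.κ₂ i).im ≤ T}.Finite) ∧
  Summable (fun i ↦ Z.m₁ i / (Z.κ₁ i).im ^ 2 + Z.m₂ i / (Z.κ₂ i).im ^ 2) ∧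
  (∀ i, ∃ j, (Z.κ₁ i).re < (Z.κ₁ j).re) ∧
  (∃ A : ℝ, 0 < A ∧ ∀ k : ℕ, 1 ≤ k → 2 * A ≤ Z.fold h k ∧ Z.fold h k ≤ 6 * A) ∧
  (∀ (N : ℕ) (t x : Fin N → ℝ), (∀ a, t a ∈ Set.range fun k : ℕ ↦ (k : ℝ) * h) →
      0 ≤ ∑ a, ∑ b, (modelPsi Z.m₁ Z.m₂ Z.κ₁ Z.κ₂ (t a) + modelPsi Z.m₁ Z.m₂ Z.κ₁ Z.κ₂ (t b)
        - modelPsi Z.m₁ Z.m₂ Z.κ₁ Z.κ₂ (t a - t b)) * (x a * x b)) ∧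
  (∀ σ < σs, {i | (Z.κ₁ i).re ≤ σ}.Finite) ∧
  (∃ B : ℝ, ∀ i, 1 ≤ Z.m₁ i ∧ Z.m₁ i ≤ B ∧ 1 ≤ Z.m₂ i ∧ Z.m₂ i ≤ B) ∧
  (∃ C : ℝ, ∀ T : ℝ, 1 ≤ T → ∃ s : Finset Z.ι,
      (∀ i, (Z.κ₁ i).im ≤ T ∨ (Z.κ₂ i).im ≤ T → i ∈ s) ∧ (s.card : ℝ) ≤ C * T ^ e)

/-- **Class C (candidate A, clause-generated).**  A lattice criterion `P` at step `h` is of class C if, for some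
width `σ* > 0` and some exponent `e > 0`, it is a consequence of the thin blind model's clause list: every
configuration with one-sided sampled lattice bounds (floor, ceiling, `LPSD(h)`), thin ordinate count `≤ C T^e`,
multiplicity band, `Σ m/γ² < ∞`, abscissae in `(0, σ*)` discrete below `σ*` satisfies `P`.  PER-`e` MODEL: the
blind configuration refuting a class-C criterion depends on the exponent `e` (and on `σ*`, `h`); there is no single
configuration thin for every `e` in this file.  (Zero-counting conjuncts up to `T^e`, density and multiplicity
conjuncts read from these data are of class C; continuum-`Ψ` functionals and the full fold as a datum are not.) -/
def ClassC (h : ℝ) (P : Config → Prop) : Prop :=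
  ∃ σs e : ℝ, 0 < σs ∧ 0 < e ∧ ∀ Z : Config, ThinBlindClauses h σs e Z → P Z

/-- The thin blind model, repackaged: for every `h, σ*, e > 0` some configuration satisfies the clause list. -/
theorem exists_thinBlindClauses {h σs e : ℝ} (hh : 0 < h) (hσs : 0 < σs) (he : 0 < e) :
    ∃ Z : Config, ThinBlindClauses h σs e Z := by
  have hc : (0 : ℝ) < 1 / ((⌈4 / e⌉₊ : ℕ) + 3 : ℝ) := by positivity
  obtain ⟨ι, m₁, m₂, κ₁, κ₂, H⟩ := exists_tower_thin_blind_model hh hσs hc he le_rfl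
  exact ⟨⟨ι, m₁, m₂, κ₁, κ₂⟩, H⟩

/-- **The TOWER barrier in class form.**  Every class-C criterion at a step `h > 0` is satisfied by a NON-EMPTY
off-line configuration all of whose abscissae are positive and whose supremum abscissa is NOT attained (zeros
off every line bounding the configuration): the thin polygon tower. -/
theorem classC_blind_to_tower {h : ℝ} (hh : 0 < h) {P : Config → Prop} (hP : ClassC h P) :
    ∃ Z : Config, P Z ∧ Nonempty Z.ι ∧ (∀ i, 0 < (Z.κ₁ i).re) ∧ (∀ i, ∃ j, (Z.κ₁ i).re < (Z.κ₁ j).re) := by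
  obtain ⟨σs, e, hσs, he, hPZ⟩ := hP
  obtain ⟨Z, hZ⟩ := exists_thinBlindClauses hh hσs he
  exact ⟨Z, hPZ Z hZ, hZ.1, fun i ↦ (hZ.2.2.1 i).1, hZ.2.2.2.2.2.2.1⟩

/-- **No class-C criterion implies RH-emptiness.**  For `ζ`, RH says the off-line configuration is empty; no
criterion of class C (at any step `h > 0`) forces that — nor even an attained supremum abscissa. -/
theorem not_criterion_of_classC {h : ℝ} (hh : 0 < h) {P : Config → Prop} (hP : ClassC h P) :
    ¬ (∀ Z : Config, P Z → IsEmpty Z.ι) ∧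
    ¬ (∀ Z : Config, P Z → ∃ i, ∀ j, (Z.κ₁ j).re ≤ (Z.κ₁ i).re) := by
  obtain ⟨Z, hPZ, hne, -, hsup⟩ := classC_blind_to_tower hh hP
  refine ⟨fun H ↦ ?_, fun H ↦ ?_⟩
  · exact (H Z hPZ).false hne.some
  · obtain ⟨i, hi⟩ := H Z hPZ
    obtain ⟨j, hj⟩ := hsup i
    exact absurd (hi j) (not_le.mpr hj)

end Summit.RiemannHypothesis.RiemannHypothesis.Theorems.Splittings.ScrewLatticeTower

end
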